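import Literature.NumberTheory.GaloisRepresentations.ContinuousCorestrictionTransport
import HarnessLib

/-!
# Corestriction commutes with pull-back along a homomorphism meeting every coset

Theorems only (no definition, no named fact, no instance). Generalisation of the tree's
`cores_map_eq_map_cores` (`ContinuousCorestrictionTransport.lean`, there for a BIJECTIVE `θ`): for a
continuous homomorphism `θ : G' → G` of topological groups, an open subgroup `N ≤ G` of finite index
with preimage `N' = θ⁻¹(N)`, such that **the image of `θ` meets every coset of `N`**
(`∀ g, ∃ g', (θ g')⁻¹ g ∈ N`, i.e. `θ(G') · N = G`; no injectivity is required), topological modules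
`X` of `G`, `X'` of `G'` and a compatible map `f : res θ X ⟶ X'`, the pull-backs intertwine the
transfer corestrictions:

  `cor_{G'/N'} (H¹(θ|_{N'}, f) y) = H¹(θ, f) (cor_{G/N} y)`   (`cores_map_eq_map_cores_of_forall_exists`).

On cocycles this is an equality for the system of representatives of `G ⧸ N` chosen INSIDE the image
of `θ` (possible by the hypothesis) and the transported representatives of `G' ⧸ N'` along the
bijection `θ̄ : G' ⧸ N' ≃ G ⧸ N`; `cores` does not depend on the representatives (`cores_oneCocycleClass`).
This is the single-double-coset case `res_D ∘ cor^G_N = cor^D_{D ∩ N} ∘ res` of the Mackey formula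
(Neukirch–Schmidt–Wingberg (1.5.6)) read through `θ : G' → D = θ(G') ≤ G`; typical use: `θ` the
restriction `Γ_{K_v} → Γ_K` into the layers of a `ℤ_p`-extension in which `v` is totally ramified
(local and global trace maps agree: `loc ∘ Cor_{ℚ_{n+1}/ℚ_n} = Cor_{ℚ_{n+1,v}/ℚ_{n,v}} ∘ loc`).

## References
* J. Neukirch, A. Schmidt, K. Wingberg, *Cohomology of Number Fields* (2008), I §5 Prop. 1.5.4 and
  (1.5.6)–(1.5.7) (double coset formula). [NeukirchSchmidtWingberg2008]
* J.-P. Serre, *Galois Cohomology* (1997), I §2.4 (compatible pairs). [SerreGaloisCohomology1997]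
-/

noncomputable section

open CategoryTheory Function Finset

universe u v

namespace Literature.NumberTheory.GaloisRepresentations

open Literature.NumberTheory.EllipticCurves (schreierElt schreierElt_mem schreierElt_coe
  subgroupInclusion subgroupInclusion_apply_coe)

variable {R : Type u} [Ring R] [TopologicalSpace R]
variable {G G' : Type v} [Group G] [TopologicalSpace G] [IsTopologicalGroup G]
  [Group G'] [TopologicalSpace G'] [IsTopologicalGroup G']

section TransportOnto

variable (X : TopRep.{v} R G) (X' : TopRep.{v} R G') (θ : G' →ₜ* G)
  (f : TopRep.res (θ : G' →* G) X ⟶ X') (N : Subgroup G) [Fintype (G ⧸ N)]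
  [Fintype (G' ⧸ N.comap (θ : G' →* G))]

/-- **Corestriction commutes with pull-back along `θ : G' → G` whenever `θ(G') N = G`**:
`cor_{G'/θ⁻¹N} (H¹(θ|, f) y) = H¹(θ, f) (cor_{G/N} y)` on `H¹(N, X)` (no injectivity or surjectivity of
`θ` needed beyond the coset condition). [cite: NeukirchSchmidtWingberg2008, I §5 Prop. 1.5.4]
[cite: NeukirchSchmidtWingberg2008, I §5 (1.5.6)] -/
theorem cores_map_eq_map_cores_of_forall_exists (hcos : ∀ g : G, ∃ g' : G', (θ g')⁻¹ * g ∈ N)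
    (hN : IsOpen (N : Set G)) (hN' : IsOpen ((N.comap (θ : G' →* G) : Subgroup G') : Set G'))
    (y : continuousCohomology 1 (subgroupRep X N)) :
    cores X' (N.comap (θ : G' →* G)) hN'
        (ContinuousCohomology.map (comapRestrictHom θ N) (comapRestrictRepHom X X' θ f N) 1 y) =
      ContinuousCohomology.map θ f 1 (cores X N hN y) := by
  classical
  obtain ⟨φ, rfl⟩ := oneCocycleClass_surjective _ y
  -- representatives of `G ⧸ N` inside the image of `θ`
  set σ : G ⧸ N → G' := fun c => (hcos c.out).choose with hσ_def
  have hσ : ∀ c : G ⧸ N, (θ (σ c))⁻¹ * c.out ∈ N := fun c => (hcos c.out).choose_spec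
  set s : G ⧸ N → G := fun c => θ (σ c) with hs_def
  have hs : ∀ x : G ⧸ N, (s x : G ⧸ N) = x := fun c => by
    conv_rhs => rw [← QuotientGroup.out_eq' c]
    exact QuotientGroup.eq.mpr (hσ c)
  -- `θ̄ : G' ⧸ N.comap θ → G ⧸ N`, a bijection
  set θbar : G' ⧸ N.comap (θ : G' →* G) → G ⧸ N := Quotient.map' (fun g' => θ g') (fun a b h => by
    rw [QuotientGroup.leftRel_apply] at h ⊢
    rw [← map_inv, ← map_mul]
    exact h) with hθbar_def
  have hθbar : ∀ g' : G', θbar (g' : G' ⧸ N.comap (θ : G' →* G)) = ((θ g' : G) : G ⧸ N) := fun _ => rfl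
  have hθbar_bij : Function.Bijective θbar := by
    constructor
    · intro a b hab
      induction a using QuotientGroup.induction_on with
      | H a =>
        induction b using QuotientGroup.induction_on with
        | H b =>
          rw [hθbar, hθbar, QuotientGroup.eq] at hab
          apply QuotientGroup.eq.mpr
          change θ (a⁻¹ * b) ∈ N
          rwa [map_mul, map_inv]
    · intro x
      induction x using QuotientGroup.induction_on with
      | H g =>
        obtain ⟨g', hg'⟩ := hcos g
        exact ⟨(g' : G' ⧸ N.comap (θ : G' →* G)), by rw [hθbar]; exact QuotientGroup.eq.mpr hg'⟩
  set ebar : G' ⧸ N.comap (θ : G' →* G) ≃ G ⧸ N := Equiv.ofBijective θbar hθbar_bij with hebar_def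
  -- the transported representatives of `G' ⧸ N.comap θ`
  set s' : G' ⧸ N.comap (θ : G' →* G) → G' := fun x' => σ (ebar x') with hs'_def
  have hθs' : ∀ x', θ (s' x') = s (ebar x') := fun _ => rfl
  have hs' : ∀ x' : G' ⧸ N.comap (θ : G' →* G), (s' x' : G' ⧸ N.comap (θ : G' →* G)) = x' := fun x' => by
    induction x' using QuotientGroup.induction_on with
    | H a =>
      refine (QuotientGroup.eq.mpr ?_).symm
      change θ (a⁻¹ * s' (a : G' ⧸ N.comap (θ : G' →* G))) ∈ N
      rw [map_mul, map_inv, hθs']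
      have h1 : ebar (a : G' ⧸ N.comap (θ : G' →* G)) = ((θ a : G) : G ⧸ N) := hθbar a
      rw [h1]
      exact QuotientGroup.eq.mp (hs _).symm
  -- `θ̄` is `G'`-equivariant
  have hsmul : ∀ (g' : G') (x' : G' ⧸ N.comap (θ : G' →* G)), ebar (g' • x') = θ g' • ebar x' := fun g' x' => by
    induction x' using QuotientGroup.induction_on with
    | H a =>
      change θbar ((g' * a : G') : G' ⧸ N.comap (θ : G' →* G)) = θ g' • θbar (a : G' ⧸ N.comap (θ : G' →* G))
      rw [hθbar, hθbar, map_mul, MulAction.Quotient.smul_coe, smul_eq_mul]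
  -- `θ` of the transported Schreier elements
  have hschreier : ∀ (g' : G') (x' : G' ⧸ N.comap (θ : G' →* G)),
      θ ((schreierElt (N.comap (θ : G' →* G)) hs' g' x' : N.comap (θ : G' →* G)) : G') =
        ((schreierElt N hs (θ g') (ebar x') : N) : G) := fun g' x' => by
    rw [schreierElt_coe, schreierElt_coe, map_mul, map_mul, map_inv, hθs', hθs', hsmul]
  -- `f` intertwines
  have hf : ∀ (g : G') (m : X), f.hom (X.ρ (θ g) m) = X'.ρ g (f.hom m) := fun g m =>
    TopRep.hom_comm_apply f g m
  -- both sides as classes of explicit cocycles on `G'`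
  rw [map_oneCocycleClass, cores_oneCocycleClass X' _ hN' hs', cores_oneCocycleClass X N hN hs,
    map_oneCocycleClass]
  refine congrArg _ (Subtype.ext (ContinuousMap.ext fun g' => ?_))
  rw [transferCocycle_apply, contOneCocycles.pullback_apply, transferCocycle_apply, transferFun_apply,
    transferFun_apply, map_sum, ← ebar.sum_comp]
  refine Finset.sum_congr rfl fun x' _ => ?_
  rw [contOneCocycles.pullback_apply, ← hsmul, ← hθs' (g' • x'), hf]
  change X'.ρ (s' (g' • x')) (f.hom (φ.1 _)) = X'.ρ (s' (g' • x')) (f.hom (φ.1 _))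
  congr 3
  exact Subtype.ext (hschreier g' x')

end TransportOnto

end Literature.NumberTheory.GaloisRepresentations
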